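import Literature.AlgebraicGeometry.HodgeTheory.RealSl2BlocksTimesCMInvariance
import Literature.AlgebraicGeometry.HodgeTheory.RealSl2BlocksTimesCMPartialFFT
import Literature.AlgebraicGeometry.HodgeTheory.RealSl2Blocks
import HarnessLib

/-!
# Hodge classes on `X` with slots over `A × C` (`A` with real `𝔰𝔩₂`-block data, `C` of CM type) are combinations of (divisor classes) ∪ (monomials in the CM letters) — Lombardo 2016 Lemma 3.4 / Moonen–Zarhin 1999 (3.1), evaluated

Family `hodge`, layer `Literature/AlgebraicGeometry/HodgeTheory`. Research context: cell `pub-hodge-ring2`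
(HONEST FRAMING: research route conditional on HC_CM; not a corollary; Q11.4-sentence-2 already refuted in
dim ≥ 3), Literature lane, programme R4 («RM × CM»). UNCONDITIONAL; theorems only, no named fact; no step
towards a summit statement.

PRINTED RESULT. Lombardo 2016, Lemma 3.4 (p. 1229): for `A` without factor of type IV and `B` of CM type,
`H(A × B) ≅ H(A) × H(B)` with `H(B)` a torus; Moonen–Zarhin 1999 §3 (3.1): then the Hodge ring of every
`A^m × B^n` is generated by the classes coming from the factors. For `A` a carrier of real `𝔰𝔩₂`-block data
(`HasRealSl2Blocks A`: Hazama 1983 §3 / Ribet 1983, e.g. `End⁰(A)` a totally real field of degree `dim A`)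
the invariants of `H(A) = ∏ SL₂` in the tensor algebra of `H¹` are generated by divisor classes (Hazama's
first fundamental theorem), so the invariants of `H(A) × H(C)` are (divisor classes of the `A`-side) ⊗
(anything on the `C`-side). This file assembles the tree's two halves of that statement:
the invariance theorem `AVSlots.exists_coeff_killed_at_real_places_of_prod_cmType`
(`RealSl2BlocksTimesCMInvariance`) and the evaluation `wordEval_mem_span_divisor_cup_monomial`
(`RealSl2BlocksTimesCMPartialFFT`).

RESULTS.
* `AVSlots.prodLift` — slots over `A` on `B` and slots over `C` on `Z` (same number) pair to slots over
  `A × C` on `B × Z`.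
* `HasRealSl2Blocks.exists_cmLetters_hodgeClasses_mem_span_map_divisor_cup_monomial` — the CORE form: for `X`
  with slots `g` over `A × C` factoring through `f₁ : X → B` (`g_j ≫ pr_A = f₁ ≫ gB_j`) and `f₂ : X → Z`
  (`g_j ≫ pr_C = f₂ ≫ gC_j`), every rational `(p,p)`-class on `X` is a `ℂ`-combination of classes
  `f₁^* d ⌣ f₂^*(y_{l₁} ⌣ ⋯ ⌣ y_{l_r})`, `d ∈ D^{p'}(B) ⊗ ℂ`, `y` the letters `gC_j^* ρ(c_i^κ)` of a
  Hodge-adapted pair basis `(c_i^0, c_i^1)` of `H¹(C) ⊗ ℂ`.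
* `HasRealSl2Blocks.exists_cmLetters_hodgeClasses_mem_span_divisor_cup_monomial` — `f₁ = f₂ = 𝟙`: **the Hodge
  classes of `X` are combinations of `d ⌣ (monomial in the letters g_j^* pr_C^* ρ(c_i^κ))`, `d ∈ D(X) ⊗ ℂ`.**
* `HasRealSl2Blocks.exists_cmLetters_hodgeClasses_prod_mem_span` — `X = B × Z`, `B` with slots over `A`, `Z` with
  slots over `C`: **the Hodge classes of `B × Z` are combinations of `pr_B^* d ⌣ pr_Z^* μ`, `d ∈ D(B) ⊗ ℂ`,
  `μ` a monomial in the letters of `Z`** (the input of the Künneth/rationality upgrade to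
  `HodgeClassesProductSpan B Z`, file `RealSl2BlocksTimesCMProductSpan`).

## References

* [Lombardo2016] D. Lombardo, Ann. Inst. Fourier 66 (2016), Lemma 3.4 (p. 1229). [cite: Lombardo2016, Lemma 3.4 (p. 1229)]
* [MoonenZarhin1999LowDim] B. Moonen, Yu. Zarhin, Math. Ann. 315 (1999), §3 (3.1). [cite: MoonenZarhin1999LowDim, §3 (3.1)]
* [Hazama1983] F. Hazama, Tôhoku Math. J. 35 (1983), Thm. (1.1), §3 pp. 305–306. [cite: Hazama1983, §3 (pp. 305–306)]
* [Ribet1983] K. A. Ribet, Amer. J. Math. 105 (1983), Thm. 0–1. [cite: Ribet1983, Thm. 0–1]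
* [HatcherAT2002] A. Hatcher, *Algebraic Topology* (2002), §3.2 Thm. 3.16. [cite: HatcherAT2002, §3.2 Thm. 3.16]
-/

noncomputable section

open scoped TensorProduct
open CategoryTheory Module

namespace Literature.AlgebraicGeometry.HodgeTheory

open Literature.AlgebraicTopology.SingularHomology
open Literature.AlgebraicGeometry.Motives (IsSmoothProjective AbelianVariety bettiCohomology
  ofRatClassBaseChange ofRatClassBaseChange_tmul HodgeTensorFacts hodgeTensorFacts_holds)
open Literature.Barriers.HodgeConjecture
open Literature.AlgebraicGeometry.Motives.HodgeStructure
open Literature.AlgebraicGeometry.ComplexMultiplication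
open Literature.RepresentationTheory.GeneralLinear
open Literature.NumberTheory.DiophantineGeometry

/-! ### §1 Slots over `A × C` on `B × Z` -/

section Slots

variable {A B C Z : AbelianVariety ℂ} {n : ℕ} {gB : Fin n → (B ⟶ A)} {gC : Fin n → (Z ⟶ C)}

/-- **Pairing slot structures**: if `B` has `n` slots `gB` over `A` and `Z` has `n` slots `gC` over `C`, then
`B × Z` has `n` slots `(pr_B ≫ gB_j, pr_Z ≫ gC_j) : B × Z → A × C` over `A × C` (Künneth in degree one,
`H¹(B × Z) = pr_B^* H¹(B) ⊕ pr_Z^* H¹(Z)`, and `(pr_B ≫ gB_j)^* = (g_j ≫ pr_A)^*`).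
[cite: HatcherAT2002, §3.2 Thm. 3.16] -/
theorem AVSlots.prodLift (hB : AVSlots A B gB) (hZ : AVSlots C Z gC) :
    AVSlots (A.prod C) (B.prod Z)
      (fun j => Motives.AbelianVariety.prodLift (Motives.AbelianVariety.fst B Z ≫ gB j)
        (Motives.AbelianVariety.snd B Z ≫ gC j)) := by
  refine ⟨by rw [Motives.AbelianVariety.dim_prod, Motives.AbelianVariety.dim_prod, hB.1, hZ.1, mul_add],
    fun x => ?_⟩
  have hBs : IsSmoothProjective B.dim B.X := Motives.AbelianVariety.isSmoothProjective_holds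
  have hZs : IsSmoothProjective Z.dim Z.X := Motives.AbelianVariety.isSmoothProjective_holds
  obtain ⟨a, b, hab⟩ := exists_eq_map_fst_add_map_snd_deg_one hBs hZs x
  change x = complexBetti.map (Motives.AbelianVariety.fst B Z).hom.hom.hom 1 a +
    complexBetti.map (Motives.AbelianVariety.snd B Z).hom.hom.hom 1 b at hab
  set g : Fin n → (B.prod Z ⟶ A.prod C) := fun j => Motives.AbelianVariety.prodLift
    (Motives.AbelianVariety.fst B Z ≫ gB j) (Motives.AbelianVariety.snd B Z ≫ gC j) with hg
  set S := Submodule.span ℂ (Set.range fun q : Fin n × complexBetti (A.prod C).X 1 =>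
    complexBetti.map (g q.1).hom.hom.hom 1 q.2) with hS
  rw [hab]
  refine Submodule.add_mem _ ?_ ?_
  · have hle : Submodule.span ℂ (Set.range fun q : Fin n × complexBetti A.X 1 =>
        complexBetti.map (gB q.1).hom.hom.hom 1 q.2) ≤
        S.comap (complexBetti.map (Motives.AbelianVariety.fst B Z).hom.hom.hom 1).hom := by
      refine Submodule.span_le.2 ?_
      rintro _ ⟨⟨j, v⟩, rfl⟩
      refine Submodule.subset_span ⟨(j, complexBetti.map (Motives.AbelianVariety.fst A C).hom.hom.hom 1 v), ?_⟩
      change complexBetti.map (g j).hom.hom.hom 1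
          (complexBetti.map (Motives.AbelianVariety.fst A C).hom.hom.hom 1 v) =
        complexBetti.map (Motives.AbelianVariety.fst B Z).hom.hom.hom 1 (complexBetti.map (gB j).hom.hom.hom 1 v)
      rw [complexBetti_map_map_hom, complexBetti_map_map_hom, hg,
        Motives.AbelianVariety.prodLift_fst]
    exact hle (hB.2 a)
  · have hle : Submodule.span ℂ (Set.range fun q : Fin n × complexBetti C.X 1 =>
        complexBetti.map (gC q.1).hom.hom.hom 1 q.2) ≤
        S.comap (complexBetti.map (Motives.AbelianVariety.snd B Z).hom.hom.hom 1).hom := by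
      refine Submodule.span_le.2 ?_
      rintro _ ⟨⟨j, v⟩, rfl⟩
      refine Submodule.subset_span ⟨(j, complexBetti.map (Motives.AbelianVariety.snd A C).hom.hom.hom 1 v), ?_⟩
      change complexBetti.map (g j).hom.hom.hom 1
          (complexBetti.map (Motives.AbelianVariety.snd A C).hom.hom.hom 1 v) =
        complexBetti.map (Motives.AbelianVariety.snd B Z).hom.hom.hom 1 (complexBetti.map (gC j).hom.hom.hom 1 v)
      rw [complexBetti_map_map_hom, complexBetti_map_map_hom, hg,
        Motives.AbelianVariety.prodLift_snd]
    exact hle (hZ.2 b)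

end Slots

/-! ### §2 The core assembly: invariance theorem + evaluation -/

section Core

variable {A B C Z X : AbelianVariety ℂ} {n : ℕ}

/-- **CORE ASSEMBLY (Lombardo 2016 Lemma 3.4 / Moonen–Zarhin 1999 (3.1) for real `𝔰𝔩₂`-block data times CM
type, evaluated).** Let `A` carry real `𝔰𝔩₂`-block data, `C` be of CM type, and let `X` have slots `g` over
`A × C` whose `A`-components factor as `g_j ≫ pr_A = f₁ ≫ gB_j` through `f₁ : X → B` and whose `C`-components
factor as `g_j ≫ pr_C = f₂ ≫ gC_j` through `f₂ : X → Z`. Then there is a Hodge-adapted pair basis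
`(c_i^0 ∈ H^{1,0}, c_i^1 ∈ H^{0,1})_{i<h}` of `H¹(C) ⊗ ℂ` such that every rational class of type `(p,p)` on `X`
is a `ℂ`-combination of classes `f₁^* d ⌣ f₂^*(y_{w(1)} ⌣ ⋯ ⌣ y_{w(r)})` with `d ∈ D^{p'}(B) ⊗ ℂ`
(`divisorClassesSpan`), `2p' + r = 2p`, and `y_{((j,i),κ)} = gC_j^* ρ(c_i^κ) ∈ H¹(Z(ℂ); ℂ)`.
[cite: Lombardo2016, Lemma 3.4 (p. 1229)] [cite: MoonenZarhin1999LowDim, §3 (3.1)]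
[cite: Hazama1983, Thm. (1.1) and §3 (pp. 305–306)] -/
theorem HasRealSl2Blocks.exists_cmLetters_hodgeClasses_mem_span_map_divisor_cup_monomial
    (hA : HasRealSl2Blocks A) (hC : Milne1999.IsOfCMType C) {g : Fin n → (X ⟶ A.prod C)}
    (hg : AVSlots (A.prod C) X g) (f₁ : X ⟶ B) (f₂ : X ⟶ Z) (gB : Fin n → (B ⟶ A)) (gC : Fin n → (Z ⟶ C))
    (hf₁ : ∀ j, g j ≫ Motives.AbelianVariety.fst A C = f₁ ≫ gB j)
    (hf₂ : ∀ j, g j ≫ Motives.AbelianVariety.snd A C = f₂ ≫ gC j) :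
    ∃ (h : ℕ) (cC : Module.Basis (Fin h × Fin 2) ℂ (ℂ ⊗[ℚ] bettiCohomology C.X 1)),
      (∀ i, (cC (i, 0)) ∈ (BettiUniverse.hodge exists_isReal_hodgeModel_holds
        (Motives.AbelianVariety.isSmoothProjective_holds (A := C)) 1).piece 1 0) ∧
      (∀ i, (cC (i, 1)) ∈ (BettiUniverse.hodge exists_isReal_hodgeModel_holds
        (Motives.AbelianVariety.isSmoothProjective_holds (A := C)) 1).piece 0 1) ∧
      ∀ (p : ℕ) (c : complexBetti X.X (2 * p)), IsRationalClass c → IsOfHodgeType X.dim X.X (2 * p) p p c →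
        c ∈ Submodule.span ℂ {z : complexBetti X.X (2 * p) | ∃ (p' r : ℕ) (hpr : 2 * p' + r = 2 * p)
          (dB : complexBetti B.X (2 * p')) (w : Fin r → (Fin n × Fin h) × Fin 2),
          dB ∈ divisorClassesSpan B.X B.dim p' ∧
          z = cupProduct hpr (complexBetti.map f₁.hom.hom.hom (2 * p') dB)
            (complexBetti.map f₂.hom.hom.hom r (cupPowOne ℂ (Motives.ComplexPoints Z.X) r (fun t =>
              complexBetti.map (gC (w t).1.1).hom.hom.hom 1
                (ofRatClassBaseChange (Motives.ComplexPoints C.X) 1 (cC ((w t).1.2, (w t).2))))))} := by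
  classical
  -- unpack the real `𝔰𝔩₂`-block data of `A` (as in `HasRealSl2Blocks.isDivisorGenerated_of_avSlots`)
  obtain ⟨hc, ι, _, _, τ, hreal, hint, h2, b, hb0, hb1, hθ⟩ := hA
  have hHD : exists_isReal_hodgeModel := exists_isReal_hodgeModel_holds
  have hI : hodgePQ_independent_of_hodgeModel := hodgePQ_independent_of_hodgeModel_holds
  haveI : HodgeTensorFacts.{0, 0} := hodgeTensorFacts_holds.{0, 0}
  haveI : Module.Finite ℚ (bettiCohomology A.X 1) := finite_bettiCohomology_one A
  have hXA : IsSmoothProjective A.dim A.X := Motives.AbelianVariety.isSmoothProjective_holds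
  obtain ⟨ψ⟩ : (BettiUniverse.hodge hHD (Motives.AbelianVariety.isSmoothProjective_holds (A := A)) 1).IsPolarizable :=
    smoothProjective_hodgeStructure_isPolarizable_holds hXA (BettiUniverse.realHodgeModel hHD hXA)
      (BettiUniverse.realHodgeModel_isHodgeSymmetric hHD hXA) 1
  set Φ := endAlgebraAlgEquivEndAlgOfComm hc hHD hI with hΦ
  have heq : ∀ i, (BettiUniverse.hodge hHD (Motives.AbelianVariety.isSmoothProjective_holds (A := A)) 1).eigenBlock
      ((τ i).comp Φ.symm.toRingEquiv.toRingHom) =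
      ⨅ e : A.endAlgebra, Module.End.eigenspace ((MulOpposite.unop (bettiRep A e)).baseChange ℂ) (τ i e) :=
    fun i => eigenBlock_comp_endAlgebraAlgEquivEndAlgOfComm_symm hc hHD hI (τ i)
  have hreal' : ∀ i, (starRingEnd ℂ).comp ((τ i).comp Φ.symm.toRingEquiv.toRingHom) =
      (τ i).comp Φ.symm.toRingEquiv.toRingHom :=
    fun i => comp_endAlgebraAlgEquivEndAlgOfComm_symm_isReal hc hHD hI (hreal i)
  have hfun : (fun i => (BettiUniverse.hodge hHD (Motives.AbelianVariety.isSmoothProjective_holds (A := A)) 1).eigenBlock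
      ((τ i).comp Φ.symm.toRingEquiv.toRingHom)) = fun i => (⨅ e : A.endAlgebra,
        Module.End.eigenspace ((MulOpposite.unop (bettiRep A e)).baseChange ℂ) (τ i e) : Submodule ℂ _) :=
    funext heq
  have hint' : DirectSum.IsInternal fun i =>
      (BettiUniverse.hodge hHD (Motives.AbelianVariety.isSmoothProjective_holds (A := A)) 1).eigenBlock
        ((τ i).comp Φ.symm.toRingEquiv.toRingHom) := by
    rw [hfun]; exact hint
  have h2' : ∀ i, Module.finrank ℂ
      ((BettiUniverse.hodge hHD (Motives.AbelianVariety.isSmoothProjective_holds (A := A)) 1).eigenBlock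
        ((τ i).comp Φ.symm.toRingEquiv.toRingHom)) = 2 := fun i => by rw [heq]; exact h2 i
  have hself := isAdjointPair_self_of_real_characters
    (BettiUniverse.hodge hHD (Motives.AbelianVariety.isSmoothProjective_holds (A := A)) 1) (by norm_num)
    (BettiUniverse.hodge_isEffective hHD hXA 1) ψ _ hreal' hint'
  let b' : ∀ i, Module.Basis (Fin 2) ℂ
      ((BettiUniverse.hodge hHD (Motives.AbelianVariety.isSmoothProjective_holds (A := A)) 1).eigenBlock
        ((τ i).comp Φ.symm.toRingEquiv.toRingHom)) :=
    fun i => (b i).map (LinearEquiv.ofEq _ _ (heq i).symm)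
  have hb' : ∀ i r, (b' i r : ℂ ⊗[ℚ] bettiCohomology A.X 1) = (b i r : ℂ ⊗[ℚ] bettiCohomology A.X 1) :=
    fun i r => rfl
  have hb0' : ∀ i, (b' i 0 : ℂ ⊗[ℚ] bettiCohomology A.X 1) ∈
      (BettiUniverse.hodge hHD (Motives.AbelianVariety.isSmoothProjective_holds (A := A)) 1).piece 1 0 :=
    fun i => by rw [hb']; exact hb0 i
  have hb1' : ∀ i, (b' i 1 : ℂ ⊗[ℚ] bettiCohomology A.X 1) ∈
      (BettiUniverse.hodge hHD (Motives.AbelianVariety.isSmoothProjective_holds (A := A)) 1).piece 0 1 :=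
    fun i => by rw [hb']; exact hb1 i
  have hθ' : ∀ i, cupH1 A (b' i 0 : ℂ ⊗[ℚ] bettiCohomology A.X 1) (b' i 1) ∈
      Submodule.span ℂ {c : complexBetti A.X 2 | IsRationalClass c ∧ IsOfHodgeType A.dim A.X 2 1 1 c} :=
    fun i => by rw [hb', hb']; exact hθ i
  -- the invariance theorem for slots over `A × C`
  obtain ⟨h, cC, hcC0, hcC1, hmain⟩ := hg.exists_coeff_killed_at_real_places_of_prod_cmType hHD hI ψ hself _
    hreal' hint' h2' b' hb0' hb1' hC
  refine ⟨h, cC, hcC0, hcC1, fun p c hcQ hcpp => ?_⟩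
  rcases Nat.eq_zero_or_pos p with rfl | hp
  · -- degree `0`: `c = s · 1_X = f₁^*(s · 1_B) ⌣ f₂^*(1_Z)` with `s · 1_B ∈ D⁰(B) ⊗ ℂ`
    have h1 : c ∈ Submodule.span ℂ {singularCohomology.one ℂ (Motives.ComplexPoints X.X)} :=
      AbelianVariety.mem_divisorClassesSpan_zero X c
    obtain ⟨s, hs⟩ := Submodule.mem_span_singleton.1 h1
    refine Submodule.subset_span ⟨0, 0, rfl, s • singularCohomology.one ℂ (Motives.ComplexPoints B.X),
      Fin.elim0, Submodule.smul_mem _ _ (AbelianVariety.mem_divisorClassesSpan_zero B _), ?_⟩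
    rw [← hs, map_smul, LinearMap.map_smul₂, cupPowOne_zero]
    erw [singularCohomology.map_one, singularCohomology.map_one, cupProduct_one]
  · obtain ⟨a, hca, hkill⟩ := hmain hp hcQ hcpp
    -- the letters of `X` over `A × C` are `f₁^*`(letters of `B` over `A`) and `f₂^*`(letters of `Z` over `C`)
    have hletters : (fun jr : (Fin n × (ι ⊕ Fin h)) × Fin 2 => complexBetti.map (g jr.1.1).hom.hom.hom 1
        (Sum.elim
          (fun τ' => complexBetti.map (Motives.AbelianVariety.fst A C).hom.hom.hom 1
            (ofRatClassBaseChange (Motives.ComplexPoints A.X) 1 (b' τ' jr.2 : ℂ ⊗[ℚ] bettiCohomology A.X 1)))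
          (fun i => complexBetti.map (Motives.AbelianVariety.snd A C).hom.hom.hom 1
            (ofRatClassBaseChange (Motives.ComplexPoints C.X) 1 (cC (i, jr.2))))
          jr.1.2)) =
        fun jr : (Fin n × (ι ⊕ Fin h)) × Fin 2 => Sum.elim
          (fun τ' => complexBetti.map f₁.hom.hom.hom 1 (rmLetters gB b' ((jr.1.1, τ'), jr.2)))
          (fun i => complexBetti.map f₂.hom.hom.hom 1 ((fun y : (Fin n × Fin h) × Fin 2 =>
            complexBetti.map (gC y.1.1).hom.hom.hom 1
              (ofRatClassBaseChange (Motives.ComplexPoints C.X) 1 (cC (y.1.2, y.2)))) ((jr.1.1, i), jr.2)))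
          jr.1.2 := by
      funext jr
      obtain ⟨⟨j, t⟩, κ⟩ := jr
      rcases t with τ' | i
      · simp only [Sum.elim_inl, rmLetters_apply]
        rw [complexBetti_map_map_hom, complexBetti_map_map_hom, hf₁]
      · simp only [Sum.elim_inr]
        rw [complexBetti_map_map_hom, complexBetti_map_map_hom, hf₂]
    have hmem := wordEval_mem_span_divisor_cup_monomial f₁ f₂ gB b' hθ'
      (fun y : (Fin n × Fin h) × Fin 2 => complexBetti.map (gC y.1.1).hom.hom.hom 1
        (ofRatClassBaseChange (Motives.ComplexPoints C.X) 1 (cC (y.1.2, y.2)))) (a := a)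
      (fun U τ' => hkill U τ' _ (by simp)) (fun U τ' => hkill U τ' _ (by simp))
    rw [← hletters, hca] at hmem
    exact hmem

/-- **The Hodge classes of `X` (slots over `A × C`, `A` with real `𝔰𝔩₂`-block data, `C` of CM type) are
`ℂ`-combinations of `d ⌣ (x_{w(1)} ⌣ ⋯ ⌣ x_{w(r)})` with `d ∈ D^{p'}(X) ⊗ ℂ` a complexified divisor class and
the `x` the CM letters `g_j^* pr_C^* ρ(c_i^κ)`** — the invariants of `H(A) × H(C)` («`H(C)` a torus») in
`H^{2p}(X)` are (divisor classes) ⊗ (everything on the CM side). [cite: Lombardo2016, Lemma 3.4 (p. 1229)]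
[cite: MoonenZarhin1999LowDim, §3 (3.1)] [cite: Hazama1983, Thm. (1.1) and §3 (pp. 305–306)] -/
theorem HasRealSl2Blocks.exists_cmLetters_hodgeClasses_mem_span_divisor_cup_monomial
    (hA : HasRealSl2Blocks A) (hC : Milne1999.IsOfCMType C) {g : Fin n → (X ⟶ A.prod C)}
    (hg : AVSlots (A.prod C) X g) :
    ∃ (h : ℕ) (cC : Module.Basis (Fin h × Fin 2) ℂ (ℂ ⊗[ℚ] bettiCohomology C.X 1)),
      (∀ i, (cC (i, 0)) ∈ (BettiUniverse.hodge exists_isReal_hodgeModel_holds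
        (Motives.AbelianVariety.isSmoothProjective_holds (A := C)) 1).piece 1 0) ∧
      (∀ i, (cC (i, 1)) ∈ (BettiUniverse.hodge exists_isReal_hodgeModel_holds
        (Motives.AbelianVariety.isSmoothProjective_holds (A := C)) 1).piece 0 1) ∧
      ∀ (p : ℕ) (c : complexBetti X.X (2 * p)), IsRationalClass c → IsOfHodgeType X.dim X.X (2 * p) p p c →
        c ∈ Submodule.span ℂ {z : complexBetti X.X (2 * p) | ∃ (p' r : ℕ) (hpr : 2 * p' + r = 2 * p)
          (d : complexBetti X.X (2 * p')) (w : Fin r → (Fin n × Fin h) × Fin 2),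
          d ∈ divisorClassesSpan X.X X.dim p' ∧
          z = cupProduct hpr d (cupPowOne ℂ (Motives.ComplexPoints X.X) r (fun t =>
              complexBetti.map (g (w t).1.1 ≫ Motives.AbelianVariety.snd A C).hom.hom.hom 1
                (ofRatClassBaseChange (Motives.ComplexPoints C.X) 1 (cC ((w t).1.2, (w t).2)))))} := by
  obtain ⟨h, cC, hcC0, hcC1, hcore⟩ :=
    hA.exists_cmLetters_hodgeClasses_mem_span_map_divisor_cup_monomial hC hg (𝟙 X) (𝟙 X)
      (fun j => g j ≫ Motives.AbelianVariety.fst A C) (fun j => g j ≫ Motives.AbelianVariety.snd A C)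
      (fun j => (Category.id_comp _).symm) (fun j => (Category.id_comp _).symm)
  refine ⟨h, cC, hcC0, hcC1, fun p c hcQ hc => ?_⟩
  have hid : ∀ (k : ℕ) (v : complexBetti X.X k), complexBetti.map (𝟙 X : X ⟶ X).hom.hom.hom k v = v :=
    fun k v => by
      change complexBetti.map (𝟙 X.X) k v = v
      rw [complexBetti.map_id]
      rfl
  refine Submodule.span_mono ?_ (hcore p c hcQ hc)
  rintro z ⟨p', r, hpr, d, w, hd, rfl⟩
  refine ⟨p', r, hpr, d, w, hd, ?_⟩
  rw [hid, Motives.complexBetti_map_cupPowOne]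
  simp only [hid]

/-- **The Hodge classes of `B × Z` (`B` with slots over `A` with real `𝔰𝔩₂`-block data, `Z` with as many slots
over `C` of CM type) are `ℂ`-combinations of `pr_B^* d ⌣ pr_Z^*(y_{w(1)} ⌣ ⋯ ⌣ y_{w(r)})`, `d ∈ D^{p'}(B) ⊗ ℂ`,
`y` the letters `gC_j^* ρ(c_i^κ)` of `Z`** — «`H(B × Z) ≅ H(B) × H(Z)`» read on `H^{2p}(B × Z)`: the Hodge
classes of the product come from divisor classes of `B` and the cohomology of `Z`.
[cite: Lombardo2016, Lemma 3.4 (p. 1229)] [cite: MoonenZarhin1999LowDim, §3 (3.1)]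
[cite: Hazama1983, Thm. (1.1) and §3 (pp. 305–306)] -/
theorem HasRealSl2Blocks.exists_cmLetters_hodgeClasses_prod_mem_span (hA : HasRealSl2Blocks A)
    (hC : Milne1999.IsOfCMType C) {gB : Fin n → (B ⟶ A)} {gC : Fin n → (Z ⟶ C)} (hgB : AVSlots A B gB)
    (hgC : AVSlots C Z gC) :
    ∃ (h : ℕ) (cC : Module.Basis (Fin h × Fin 2) ℂ (ℂ ⊗[ℚ] bettiCohomology C.X 1)),
      (∀ i, (cC (i, 0)) ∈ (BettiUniverse.hodge exists_isReal_hodgeModel_holds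
        (Motives.AbelianVariety.isSmoothProjective_holds (A := C)) 1).piece 1 0) ∧
      (∀ i, (cC (i, 1)) ∈ (BettiUniverse.hodge exists_isReal_hodgeModel_holds
        (Motives.AbelianVariety.isSmoothProjective_holds (A := C)) 1).piece 0 1) ∧
      ∀ (p : ℕ) (c : complexBetti (B.prod Z).X (2 * p)), IsRationalClass c →
        IsOfHodgeType (B.prod Z).dim (B.prod Z).X (2 * p) p p c →
        c ∈ Submodule.span ℂ {z : complexBetti (B.prod Z).X (2 * p) | ∃ (p' r : ℕ) (hpr : 2 * p' + r = 2 * p)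
          (dB : complexBetti B.X (2 * p')) (w : Fin r → (Fin n × Fin h) × Fin 2),
          dB ∈ divisorClassesSpan B.X B.dim p' ∧
          z = cupProduct hpr (complexBetti.map (Motives.AbelianVariety.fst B Z).hom.hom.hom (2 * p') dB)
            (complexBetti.map (Motives.AbelianVariety.snd B Z).hom.hom.hom r
              (cupPowOne ℂ (Motives.ComplexPoints Z.X) r (fun t =>
                complexBetti.map (gC (w t).1.1).hom.hom.hom 1
                  (ofRatClassBaseChange (Motives.ComplexPoints C.X) 1 (cC ((w t).1.2, (w t).2))))))} :=
  hA.exists_cmLetters_hodgeClasses_mem_span_map_divisor_cup_monomial hC (hgB.prodLift hgC)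
    (Motives.AbelianVariety.fst B Z) (Motives.AbelianVariety.snd B Z) gB gC
    (fun _ => Motives.AbelianVariety.prodLift_fst _ _) (fun _ => Motives.AbelianVariety.prodLift_snd _ _)

end Core

end Literature.AlgebraicGeometry.HodgeTheory

end
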